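import Summits.BirchSwinnertonDyer.Rank1Residual.X5.TwoAdicTargetsMultPub
import Literature.NumberTheory.EllipticCurves.PAdicLFunctionIntegralityAtTwoNonsplitMultProofs
import HarnessLib

/-!
# Class O1 (X5, `p = 2`, non-CM): the non-split-`2` END-STATE with the integrality certificate `hint`
# DISCHARGED (INT2-AUTO-ns) — per pair the inputs are PRINT + K11a + `0 ≤ ord₂ ϖ` + `hlow`

HONEST FRAMING (cell `b2b-bsdres`, run/shared/lean/b2b/bsd-rank1-residual/, verbatim in every
file): the goal of the cell is to DELETE the COMBINATION-SHAPED residual classes of the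
Birch–Swinnerton-Dyer formula for ALL analytic-rank `≤ 1` elliptic curves over `ℚ` — "full BSD
formula for every rank `≤ 1` curve in class `C`" assembled STRICTLY from published theorems — so
that the rank-`≤ 1` remainder becomes exactly the CONSTRUCTION-SHAPED classes, which are TYPED
(missing-input `Prop`s), NOT attempted. This is not "finishing BSD". Research routes; no claim
beyond stated classes; census output = EVIDENCE, never a Literature fact; nothing here is booked;
no mark of RESIDUAL-MAP §I moves.

Unit `b2b-bsdres-cc-typer-4` (lane CLASS-CLOSURE, class O1), gen 4 — the non-split twin of
`X5/TwoAdicTargetsAlphaAuto.lean` / `X5/TwoAdicTargetsSplitAuto.lean`. Theorems only; 0 typed targets,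
0 named facts. INT2-AUTO-ns (`Literature/…/PAdicLFunctionIntegralityAtTwoNonsplitMultProofs.lean`, this
seat: `exists_iwasawaToPowerSeries_eq_of_isMultPAdicLFunctionOf_neg_one_two` — `L₂(E,T) ∈ Λ` for EVERY
curve non-split multiplicative at `2`, because `6·[0]⁺_f ∈ ℤ` there; no `E[2]` / image / Manin / `L(E,1)`
hypothesis) turns the per-curve certificate `hint : ∃ L₀, ι L₀ = ϖ · L` of the non-split consumers
(`X5/TwoAdicTargetsMultEndAlpha.lean`, `X5/TwoAdicTargetsMultPub.lean`) into the single inequality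
`0 ≤ ord₂ ϖ` on the period ratio `ϖ = Ω⁺_f/Ω_W` of the newform at level `N_E` (`hper₀`, as on the α-go
and split lines; EVIDENCE: lens-1's period census; in print per optimal curve via the Manin constant
at `2 ∥ N` plus the lattice index inside the isogeny class — a per-class DATUM, o1 refuter v8 §37 (a)).
The o1 refuter (v7 §30) had priced INT2-AUTO-ns at "`v₂(L(E,1)/Ω_W) ≥ −2`"; since
`L(E,1)/Ω_W = ϖ·[0]⁺_f` (`IsNewformOf.ratPlusSymbol_zero_mul_plusPeriod`) and `ord₂ [0]⁺_f ≥ −1` is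
automatic at a non-split `2` (`norm_ratPlusSymbol_zero_le_two_of_nonsplit`), that price is implied by
`hper₀` and nothing else is needed.

* `missingUpperBoundAt_two_nonsplit_of_mu_eq_zero_auto`, `missingUpperBoundAt_two_nonsplit_of_prop514_auto`
  (PROVED) — `hint` ↦ `hper₀`.
* **`bsdp_two_nonsplit_of_prop514_of_lowerBound_auto`** (PROVED) — the α-ns END-STATE per pair:
  `BSDp W 2` ⟸ PRINT {Prop. 5.14 at `2` (`h514`), Greenberg's non-split display at `2` (`h41`),
  modularity, GZK} + K11a (`hK`, NOT in print, AUDIT S–M: Kato §17.13 `⊗ ℚ` under `T″ = ℤ₂(φ)`) + the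
  decidable 5.14 data (`hP`, `h2`, `hΦ`) + `hper₀` + `hlow`.
* `bsdp_two_nonsplit_of_mu_eq_zero_of_lowerBound_auto` (PROVED) — the general non-split END-STATE from
  a `μ = 0` certificate (O1-A-ns line).
References: [MazurTateTeitelbaum1986Invent] §I.4, §I.8, §I.10, §I.12–13; [GreenbergLNM1716] §4
pp. 112–113, Prop. 5.14; [Miller2011LMS] Def. 1.1; [CremonaAlgorithms1997] Lemma 2.2.3.
-/

set_option autoImplicit false

noncomputable section

open scoped Classical MatrixGroups ModularForm

open CongruenceSubgroup WeierstrassCurve Literature.NumberTheory.EllipticCurves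
  Literature.NumberTheory.EllipticCurves.ModularForms
  Literature.NumberTheory.EllipticCurves.Greenberg1999
  Literature.NumberTheory.EllipticCurves.Rank1Residual
  Literature.NumberTheory.EllipticCurves.Rank1Residual.Typed

namespace Summit.BirchSwinnertonDyer.Rank1Residual.X5.O1

variable (W : WeierstrassCurve ℚ) [W.IsElliptic] [W.IsGloballyMinimal]

/-! ## §1 The non-split consumers with `hint` discharged -/

/-- **`MissingUpperBoundAt W 2` at a NON-SPLIT multiplicative `2` from `μ₂(X) = 0`, with the
integrality certificate discharged (PROVED).** As `missingUpperBoundAt_two_nonsplit_of_mu_eq_zero`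
(analytic rank `0`; `hEC`, modularity, GZK; K11a `hK`; `μ = 0` for the cyclotomic data `hμ`), with
`hint` replaced by `hper₀ : 0 ≤ ord₂ ϖ` for the period ratios of the newform at level `N_E`
(INT2-AUTO-ns, `exists_iwasawaToPowerSeries_eq_C_mul_of_isMultPAdicLFunctionOf_neg_one_two`).
[cite: MazurTateTeitelbaum1986Invent, §I.10 and §I.12] [cite: Miller2011LMS, Def. 1.1]
[cite: GreenbergLNM1716, §4 pp. 112–113] -/
theorem missingUpperBoundAt_two_nonsplit_of_mu_eq_zero_auto
    (hEC : TwoAdicEulerCharRankZeroNonsplitMult W 0)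
    (hmod : nonempty_modularParametrizationData)
    (hGZK : rank_eq_analyticRank_of_analyticRank_le_one)
    (hK : ∀ [NeZero (W.conductorNorm ℤ)] (f : CuspForm (Gamma0 (W.conductorNorm ℤ)) 2)
      (L : PowerSeries ℚ_[2]), KatoDivisibilityAtTwoNonsplitMultRat W f L)
    (hμ : ∀ (κ : ZpExtension ℚ 2) (γ : Field.absoluteGaloisGroup ℚ), κ.IsCyclotomic →
      κ.IsTopGenerator γ → IsCyclotomicVariable 2 γ → ∀ D : W.SelmerDualData κ γ, D.mu = 0)
    (hper₀ : ∀ [NeZero (W.conductorNorm ℤ)] (f : CuspForm (Gamma0 (W.conductorNorm ℤ)) 2),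
      IsNewformOf W f → ∀ ϖ : ℚ, (ϖ : ℝ) * W.realPeriodRat = plusPeriod f → 0 ≤ padicValRat 2 ϖ)
    (hr : W.analyticRank = 0) (hmult : Mult W 2)
    (hns : ¬ W.HasSplitMultiplicativeReductionAtPrime 2) : MissingUpperBoundAt W 2 :=
  missingUpperBoundAt_two_nonsplit_of_mu_eq_zero W hEC hmod hGZK hK hμ
    (fun f hf ϖ hϖ _ hL =>
      exists_iwasawaToPowerSeries_eq_C_mul_of_isMultPAdicLFunctionOf_neg_one_two hf hmult hns
        (hper₀ f hf ϖ hϖ) hL)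
    hr hmult hns

/-- **The general non-split END-STATE per pair from a `μ = 0` certificate, control slot PUBLISHED and
`hint` DISCHARGED (PROVED):** `BSDp W 2` ⟸ PRINT {Greenberg's non-split display at `2` (`h41`),
modularity, GZK} + K11a + `hμ` + `hper₀` + `hlow`. The O1-A-ns line (E[2] irreducible, where Prop. 5.14
does not apply and `hμ` is a tower-gap certificate). [cite: Miller2011LMS, Def. 1.1 and §1]
[cite: GreenbergLNM1716, §4 pp. 112–113] [cite: MazurTateTeitelbaum1986Invent, §I.12] -/
theorem bsdp_two_nonsplit_of_mu_eq_zero_of_lowerBound_auto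
    (h41 : thm41Analogue_charValue_rankZero_numberField_anyPrime)
    (hmod : nonempty_modularParametrizationData)
    (hGZK : rank_eq_analyticRank_of_analyticRank_le_one)
    (hK : ∀ [NeZero (W.conductorNorm ℤ)] (f : CuspForm (Gamma0 (W.conductorNorm ℤ)) 2)
      (L : PowerSeries ℚ_[2]), KatoDivisibilityAtTwoNonsplitMultRat W f L)
    (hμ : ∀ (κ : ZpExtension ℚ 2) (γ : Field.absoluteGaloisGroup ℚ), κ.IsCyclotomic →
      κ.IsTopGenerator γ → IsCyclotomicVariable 2 γ → ∀ D : W.SelmerDualData κ γ, D.mu = 0)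
    (hper₀ : ∀ [NeZero (W.conductorNorm ℤ)] (f : CuspForm (Gamma0 (W.conductorNorm ℤ)) 2),
      IsNewformOf W f → ∀ ϖ : ℚ, (ϖ : ℝ) * W.realPeriodRat = plusPeriod f → 0 ≤ padicValRat 2 ϖ)
    (hr : W.analyticRank = 0) (hmult : Mult W 2)
    (hns : ¬ W.HasSplitMultiplicativeReductionAtPrime 2) (hlow : MissingLowerBoundAt W 2) :
    BSDp W 2 :=
  bsdp_of_missingPPartAt W 2 hGZK (by rw [hr]; exact zero_le_one)
    (missingPPartAt_of_lower_of_upper W 2 hlow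
      (missingUpperBoundAt_two_nonsplit_of_mu_eq_zero_auto W
        (twoAdicEulerCharRankZeroNonsplitMult_zero_of_greenberg W h41) hmod hGZK hK hμ hper₀ hr hmult
        hns))

/-- **α-ns upper half with the integrality certificate discharged (PROVED):** `MissingUpperBoundAt W 2`
on the Prop. 5.14 locus at a non-split `2` from PRINT {5.14@2 `h514`, `hEC`, modularity, GZK} + K11a +
`hper₀`. [cite: GreenbergLNM1716, Prop. 5.14 (p. 121) and §4 pp. 112–113]
[cite: MazurTateTeitelbaum1986Invent, §I.12] [cite: Miller2011LMS, Def. 1.1] -/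
theorem missingUpperBoundAt_two_nonsplit_of_prop514_auto (h514 : prop514_isTorsion_mu_eq_zero_two)
    (hEC : TwoAdicEulerCharRankZeroNonsplitMult W 0) (hmod : nonempty_modularParametrizationData)
    (hGZK : rank_eq_analyticRank_of_analyticRank_le_one)
    (hK : ∀ [NeZero (W.conductorNorm ℤ)] (f : CuspForm (Gamma0 (W.conductorNorm ℤ)) 2)
      (L : PowerSeries ℚ_[2]), KatoDivisibilityAtTwoNonsplitMultRat W f L)
    (hper₀ : ∀ [NeZero (W.conductorNorm ℤ)] (f : CuspForm (Gamma0 (W.conductorNorm ℤ)) 2),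
      IsNewformOf W f → ∀ ϖ : ℚ, (ϖ : ℝ) * W.realPeriodRat = plusPeriod f → 0 ≤ padicValRat 2 ϖ)
    (hr : W.analyticRank = 0) (hmult : Mult W 2) (hns : ¬ W.HasSplitMultiplicativeReductionAtPrime 2)
    {x y : ℚ} (hP : W.toAffine.Equation x y) (h2 : 2 * y + W.a₁ * x + W.a₃ = 0)
    (hΦ : (TwoTorsionRamifiedAtTwo x ∧ ¬ TwoTorsionOdd W x) ∨
      (TwoTorsionOdd W x ∧ ¬ TwoTorsionRamifiedAtTwo x)) : MissingUpperBoundAt W 2 :=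
  missingUpperBoundAt_two_nonsplit_of_mu_eq_zero_auto W hEC hmod hGZK hK
    (fun _ _ hκ hγ _ D => (h514.of_mult W hmult hP h2 hΦ hκ hγ D).2) hper₀ hr hmult hns

/-- **α-ns END-STATE per pair with the control slot PUBLISHED and the integrality certificate
DISCHARGED: `BSD(E,2)` on the Prop. 5.14 locus at a non-split multiplicative `2` from the lower half
(PROVED).** Per pair the inputs are PRINT {Prop. 5.14 at `2` (`h514`), Greenberg's non-split display at
`2` (`h41`), modularity (`hmod`), GZK (`hGZK`)} + K11a (`hK`, NOT in print; price AUDIT S–M) + the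
decidable 5.14 data (`hP`, `h2`, `hΦ`) + two per-pair inputs {`hper₀` (`0 ≤ ord₂(Ω⁺_f/Ω_W)`), `hlow`
(`MissingLowerBoundAt W 2`)}. One member per isogeny class suffices (`bsdp_two_iff_of_isIsogenous`).
Nothing is booked. [cite: GreenbergLNM1716, Prop. 5.14 (p. 121) and §4 pp. 112–113]
[cite: Miller2011LMS, Def. 1.1 and §1] [cite: MazurTateTeitelbaum1986Invent, §I.12] -/
theorem bsdp_two_nonsplit_of_prop514_of_lowerBound_auto
    (h514 : prop514_isTorsion_mu_eq_zero_two)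
    (h41 : thm41Analogue_charValue_rankZero_numberField_anyPrime)
    (hmod : nonempty_modularParametrizationData)
    (hGZK : rank_eq_analyticRank_of_analyticRank_le_one)
    (hK : ∀ [NeZero (W.conductorNorm ℤ)] (f : CuspForm (Gamma0 (W.conductorNorm ℤ)) 2)
      (L : PowerSeries ℚ_[2]), KatoDivisibilityAtTwoNonsplitMultRat W f L)
    (hper₀ : ∀ [NeZero (W.conductorNorm ℤ)] (f : CuspForm (Gamma0 (W.conductorNorm ℤ)) 2),
      IsNewformOf W f → ∀ ϖ : ℚ, (ϖ : ℝ) * W.realPeriodRat = plusPeriod f → 0 ≤ padicValRat 2 ϖ)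
    (hr : W.analyticRank = 0) (hmult : Mult W 2) (hns : ¬ W.HasSplitMultiplicativeReductionAtPrime 2)
    {x y : ℚ} (hP : W.toAffine.Equation x y) (h2 : 2 * y + W.a₁ * x + W.a₃ = 0)
    (hΦ : (TwoTorsionRamifiedAtTwo x ∧ ¬ TwoTorsionOdd W x) ∨
      (TwoTorsionOdd W x ∧ ¬ TwoTorsionRamifiedAtTwo x))
    (hlow : MissingLowerBoundAt W 2) : BSDp W 2 :=
  bsdp_of_missingPPartAt W 2 hGZK (by rw [hr]; exact zero_le_one)
    (missingPPartAt_of_lower_of_upper W 2 hlow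
      (missingUpperBoundAt_two_nonsplit_of_prop514_auto W h514
        (twoAdicEulerCharRankZeroNonsplitMult_zero_of_greenberg W h41) hmod hGZK hK hper₀ hr hmult
        hns hP h2 hΦ))

end Summit.BirchSwinnertonDyer.Rank1Residual.X5.O1

end
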